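import Literature.AlgebraicGeometry.Frobenioids.BaseSectionsOfObjectsCor57bProofs
import Literature.AlgebraicGeometry.Frobenioids.EquivalenceThm34iiiOfPreSteps
import Literature.AlgebraicGeometry.Frobenioids.EquivalencePreStepsThm34iiClosers
import Literature.AlgebraicGeometry.Frobenioids.Thm34vSlim
import HarnessLib

/-!
# Frobenioids I, Corollary 5.7 (Category-theoreticity of Base-Sections) and the slim case of Corollary 4.11 (ii)
# over bases of FSMFF-type in the author's REVISED (2024) sense

Mochizuki, *The geometry of Frobenioids I: the general theory*, Kyushu J. Math. **62** (2008)
293–400, Cor. 5.7 (i)–(iv) pp. 107–108, proof p. 108 ll. 15–21 ("… But this follows from Theorem 3.4, (i),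
(iii); Corollary 4.10; Corollary 4.11, (ii)") [cite: MochizukiFrdI2008, Cor. 5.7 p.107]; Cor. 4.11 (ii) p. 91 and
Rem. 4.11.1 p. 94 (the slim case of Cor. 4.11 (ii) = Thm. 3.4 (v)) [cite: MochizukiFrdI2008, Rem. 4.11.1 p.94];
hypothesis (d) "FSMFF-type" of "standard type" (Def. 3.1 (i) p. 56) read as revised in the author's *Comments*
(January 2024), item (28) [cite: MochizukiFrdIComments2024, (28) p.3].

PROOF-ONLY file (seat abc-iut-w4-d088; downstream of GAP-LEDGER row G-L1d8-1 "printed generality of [FrdI]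
Thm. 3.4", per abc-iut-L1-lead R97 (2)/R98 (3)). Abc-iut-w4-d086's `BaseSectionsOfObjectsCor57FSM.lean` /
`BaseSectionsOfObjectsCor57Slim.lean` discharge the Thm. 3.4 inputs of abc-iut-L1-d6's conditional proofs of
Cor. 5.7 (`cor57i_sections_of`, `cor57i_pairs_of`, `isOfPreModelType_iff_of`, `cor57ii_of_cor411ii`, `cor57iii_of`,
`cor57iv_of`) over bases of FSM-type. Here the SAME is done over the wider class of bases of FSMFF-type in the
revised sense — the statement of Thm. 3.4 as the author currently asserts it — using abc-iut-L1-t11's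
`FrdI.thm34ii_ofFunctor_of_isOfFSMFFType2024` and `FrdI.thm34iii_ofFunctor_of_isOfFSMFFType2024` (the latter over the
(ii)-agnostic re-derivation `FrdI.OfPreSteps.*` of abc-iut-L1-t13's Thm. 3.4 (iii) chain):
* base-agnostic: `cor411ii_inst_of_isSlim_of_thm34iii` — the typed per-instance Cor. 4.11 (ii) over SLIM bases from the
  typed Thm. 3.4 (iii) for `Ψ`, `Ψ⁻¹` (Rem. 4.11.1; abc-iut-L1-d4's `thm34v_conclusion_of_preserves_baseIso`);
* `cor411ii_inst_of_isSlim_of_isOfFSMFFType2024`;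
* Cor. 5.7 (i), (iii), (iv) over FSMFF-type (revised) bases conditional ONLY on the typed per-instance Cor. 4.11 (ii)
  (`…_of_isOfFSMFFType2024`), and Cor. 5.7 (i)–(iv) UNCONDITIONALLY over SLIM FSMFF-type (revised) bases
  (`…_of_isSlim2024`); since FSM-type ⇒ FSMFF-type (revised) (`IsOfFSMType.isOfFSMFFType2024`) these subsume w4-d086's.
Nothing here is specific to the abc programme; no statement of the paper is restated or strengthened; no new
definition; nothing bears on [IUTchIII] Cor. 3.12.
-/

namespace Literature.AlgebraicGeometry.Frobenioids

open CategoryTheory Opposite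

universe w v v' u u'

namespace PreFrobenioid

section Cor57FSMFF2024

variable {D₁ : Type u} [Category.{v} D₁] {Φ₁ : D₁ᵒᵖ ⥤ CommMonCat.{w}}
  {C₁ : Type u'} [Category.{v'} C₁] (F₁ : C₁ ⥤ ElemFrobenioid Φ₁)
  {D₂ : Type u} [Category.{v} D₂] {Φ₂ : D₂ᵒᵖ ⥤ CommMonCat.{w}}
  {C₂ : Type u'} [Category.{v'} C₂] (F₂ : C₂ ⥤ ElemFrobenioid Φ₂) (Ψ : C₁ ≌ C₂)

/-! ### The slim case of Cor. 4.11 (ii) from Thm. 3.4 (iii) (Rem. 4.11.1), base-agnostic -/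

/-- **[FrdI] Cor. 4.11 (ii) over SLIM bases, from the typed Thm. 3.4 (iii) for `Ψ` and `Ψ⁻¹`** (Rem. 4.11.1:
the slim case of Cor. 4.11 (ii) is Thm. 3.4 (v)): for Frobenioids `C_i → F_{Φ_i}` over slim bases, under the
Cor. 4.11 setting (Div-slim, standard type, hypothesis (b)) there is a `1`-unique `Ψ^Base : D₁ → D₂` with the
`1`-commutative projection square and rigid composites — `Ψ`, `Ψ⁻¹` preserve base-isomorphisms by the typed
Thm. 3.4 (iii), then abc-iut-L1-d4's capstone. No hypothesis on `D₁, D₂` beyond slimness.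
[cite: MochizukiFrdI2008, Cor. 4.11 (ii) p.91] -/
theorem cor411ii_inst_of_isSlim_of_thm34iii (hF₁ : IsFrobenioid F₁) (hF₂ : IsFrobenioid F₂)
    (hs₁ : IsSlim D₁) (hs₂ : IsSlim D₂)
    (h3 : (PreFrobenioidData.ofFunctor Φ₁ F₁).Thm34iii (PreFrobenioidData.ofFunctor Φ₂ F₂) Ψ)
    (h3' : (PreFrobenioidData.ofFunctor Φ₂ F₂).Thm34iii (PreFrobenioidData.ofFunctor Φ₁ F₁) Ψ.symm) :
    (PreFrobenioidData.ofFunctor Φ₁ F₁).Cor411ii (PreFrobenioidData.ofFunctor Φ₂ F₂) Ψ := by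
  intro hset
  have hB' : (PreFrobenioidData.ofFunctor Φ₂ F₂).HypB (PreFrobenioidData.ofFunctor Φ₁ F₁) Ψ.symm :=
    fun g₂ g₁ => ⟨(hset.hypB g₁ g₂).2, (hset.hypB g₁ g₂).1⟩
  have h := h3 hset.standard.1 hset.standard.2 hset.hypB
  have h' := h3' hset.standard.2 hset.standard.1 hB'
  obtain ⟨-, -, ΨBase, hsq, hr₁, hr₂⟩ := thm34v_conclusion_of_preserves_baseIso hF₁ hF₂ Ψ hs₁ hs₂
    (fun X Y f hf => h.1.2.2.1 f hf) (fun X Y f hf => h'.1.2.2.1 f hf)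
  exact ⟨ΨBase, hsq, fun _ _ => ⟨hr₁, hr₂⟩⟩

/-! ### Instances over bases of FSMFF-type in the revised (2024) sense -/

/-- **[FrdI] Cor. 4.11 (ii) over SLIM bases of FSMFF-type (revised)**: the typed per-instance `Cor411ii` holds
(Thm. 3.4 (iii) over such bases for `Ψ`, `Ψ⁻¹` — abc-iut-L1-t11 — then `cor411ii_inst_of_isSlim_of_thm34iii`).
[cite: MochizukiFrdI2008, Cor. 4.11 (ii) p.91] [cite: MochizukiFrdIComments2024, (28) p.3] -/
theorem cor411ii_inst_of_isSlim_of_isOfFSMFFType2024 (hF₁ : IsFrobenioid F₁) (hF₂ : IsFrobenioid F₂)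
    (hD₁ : IsOfFSMFFType2024 D₁) (hD₂ : IsOfFSMFFType2024 D₂) (hs₁ : IsSlim D₁) (hs₂ : IsSlim D₂) :
    (PreFrobenioidData.ofFunctor Φ₁ F₁).Cor411ii (PreFrobenioidData.ofFunctor Φ₂ F₂) Ψ :=
  cor411ii_inst_of_isSlim_of_thm34iii F₁ F₂ Ψ hF₁ hF₂ hs₁ hs₂
    (FrdI.thm34iii_ofFunctor_of_isOfFSMFFType2024 hF₁ hF₂ hD₁ hD₂ Ψ)
    (FrdI.thm34iii_ofFunctor_symm_of_isOfFSMFFType2024 hF₁ hF₂ hD₁ hD₂ Ψ)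

/-! ### Cor. 5.7 over bases of FSMFF-type (revised), conditional only on the typed Cor. 4.11 (ii) -/

/-- **Corollary 5.7 (i), base-sections, over FSMFF-type (revised) bases** — conditional only on the typed
Cor. 4.11 (ii) for `Ψ`. [cite: MochizukiFrdI2008, Cor. 5.7 (i) p.107] [cite: MochizukiFrdIComments2024, (28) p.3] -/
theorem cor57i_sections_of_isOfFSMFFType2024 (hD₁ : IsOfFSMFFType2024 D₁) (hD₂ : IsOfFSMFFType2024 D₂)
    (h411 : (PreFrobenioidData.ofFunctor Φ₁ F₁).Cor411ii (PreFrobenioidData.ofFunctor Φ₂ F₂) Ψ) :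
    Cor57i_sections F₁ F₂ Ψ := fun hyp =>
  cor57i_sections_of F₁ F₂ Ψ
    (FrdI.thm34iii_ofFunctor_of_isOfFSMFFType2024 hyp.isFrobenioid₁ hyp.isFrobenioid₂ hD₁ hD₂ Ψ) h411 hyp

/-- **Corollary 5.7 (i), quasi-base-Frobenius pairs, over FSMFF-type (revised) bases** — conditional only on the
typed Cor. 4.11 (ii) for `Ψ`. [cite: MochizukiFrdI2008, Cor. 5.7 (i) p.107] [cite: MochizukiFrdIComments2024, (28) p.3] -/
theorem cor57i_pairs_of_isOfFSMFFType2024 (hD₁ : IsOfFSMFFType2024 D₁) (hD₂ : IsOfFSMFFType2024 D₂)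
    (h411 : (PreFrobenioidData.ofFunctor Φ₁ F₁).Cor411ii (PreFrobenioidData.ofFunctor Φ₂ F₂) Ψ) :
    Cor57i_pairs F₁ F₂ Ψ := fun hyp =>
  cor57i_pairs_of F₁ F₂ Ψ
    (FrdI.thm34iii_ofFunctor_of_isOfFSMFFType2024 hyp.isFrobenioid₁ hyp.isFrobenioid₂ hD₁ hD₂ Ψ) h411 hyp

/-- **Corollary 5.7 (i), "`C₁` is of (pre-)model type iff `C₂` is", over FSMFF-type (revised) bases** —
conditional only on the typed Cor. 4.11 (ii) for `Ψ` and `Ψ⁻¹`.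
[cite: MochizukiFrdI2008, Cor. 5.7 (i) p.107] [cite: MochizukiFrdIComments2024, (28) p.3] -/
theorem isOfPreModelType_iff_of_isOfFSMFFType2024 (hD₁ : IsOfFSMFFType2024 D₁) (hD₂ : IsOfFSMFFType2024 D₂)
    (h411 : (PreFrobenioidData.ofFunctor Φ₁ F₁).Cor411ii (PreFrobenioidData.ofFunctor Φ₂ F₂) Ψ)
    (h411' : (PreFrobenioidData.ofFunctor Φ₂ F₂).Cor411ii (PreFrobenioidData.ofFunctor Φ₁ F₁) Ψ.symm)
    (hyp : Cor57Hypotheses F₁ F₂ Ψ) : IsOfPreModelType F₁ ↔ IsOfPreModelType F₂ :=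
  isOfPreModelType_iff_of F₁ F₂ Ψ
    (FrdI.thm34iii_ofFunctor_of_isOfFSMFFType2024 hyp.isFrobenioid₁ hyp.isFrobenioid₂ hD₁ hD₂ Ψ) h411
    (FrdI.thm34iii_ofFunctor_symm_of_isOfFSMFFType2024 hyp.isFrobenioid₁ hyp.isFrobenioid₂ hD₁ hD₂ Ψ) h411' hyp

/-- **Corollary 5.7 (iii) over FSMFF-type (revised) bases** — conditional only on the typed Cor. 4.11 (ii) for `Ψ`.
[cite: MochizukiFrdI2008, Cor. 5.7 (iii) p.108] [cite: MochizukiFrdIComments2024, (28) p.3] -/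
theorem cor57iii_of_isOfFSMFFType2024 (B₁ : (PreFrobenioidData.ofFunctor Φ₁ F₁).BiratData)
    (B₂ : (PreFrobenioidData.ofFunctor Φ₂ F₂).BiratData) (hD₁ : IsOfFSMFFType2024 D₁) (hD₂ : IsOfFSMFFType2024 D₂)
    (h411 : (PreFrobenioidData.ofFunctor Φ₁ F₁).Cor411ii (PreFrobenioidData.ofFunctor Φ₂ F₂) Ψ) :
    Cor57iii F₁ F₂ Ψ B₁ B₂ := fun hyp =>
  cor57iii_of F₁ F₂ Ψ B₁ B₂
    (FrdI.thm34iii_ofFunctor_of_isOfFSMFFType2024 hyp.isFrobenioid₁ hyp.isFrobenioid₂ hD₁ hD₂ Ψ) h411 hyp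

/-- **Corollary 5.7 (iv) over FSMFF-type (revised) bases** — conditional only on the typed Cor. 4.11 (ii) for
`Ψ` (the Thm. 3.4 (ii) inputs for `Ψ`, `Ψ⁻¹` and the Thm. 3.4 (iii) input are theorems over such bases).
[cite: MochizukiFrdI2008, Cor. 5.7 (iv) p.108] [cite: MochizukiFrdIComments2024, (28) p.3] -/
theorem cor57iv_of_isOfFSMFFType2024 (B₁ : (PreFrobenioidData.ofFunctor Φ₁ F₁).BiratData)
    (B₂ : (PreFrobenioidData.ofFunctor Φ₂ F₂).BiratData) (hD₁ : IsOfFSMFFType2024 D₁) (hD₂ : IsOfFSMFFType2024 D₂)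
    (h411 : (PreFrobenioidData.ofFunctor Φ₁ F₁).Cor411ii (PreFrobenioidData.ofFunctor Φ₂ F₂) Ψ) :
    Cor57iv F₁ F₂ Ψ B₁ B₂ := fun hyp =>
  cor57iv_of F₁ F₂ Ψ B₁ B₂
    (FrdI.thm34ii_ofFunctor_of_isOfFSMFFType2024 hyp.isFrobenioid₁ hyp.isFrobenioid₂ hD₁ hD₂ Ψ)
    (FrdI.thm34ii_ofFunctor_symm_of_isOfFSMFFType2024 hyp.isFrobenioid₁ hyp.isFrobenioid₂ hD₁ hD₂ Ψ)
    (FrdI.thm34iii_ofFunctor_of_isOfFSMFFType2024 hyp.isFrobenioid₁ hyp.isFrobenioid₂ hD₁ hD₂ Ψ) h411 hyp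

/-! ### Cor. 5.7 UNCONDITIONALLY over slim bases of FSMFF-type (revised) -/

/-- **[FrdI] Cor. 5.7 (i), base-sections, UNCONDITIONALLY over slim bases of FSMFF-type (revised).**
[cite: MochizukiFrdI2008, Cor. 5.7 (i) p.107] [cite: MochizukiFrdIComments2024, (28) p.3] -/
theorem cor57i_sections_of_isSlim2024 (hD₁ : IsOfFSMFFType2024 D₁) (hD₂ : IsOfFSMFFType2024 D₂)
    (hs₁ : IsSlim D₁) (hs₂ : IsSlim D₂) : Cor57i_sections F₁ F₂ Ψ := fun hyp =>
  cor57i_sections_of_isOfFSMFFType2024 F₁ F₂ Ψ hD₁ hD₂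
    (cor411ii_inst_of_isSlim_of_isOfFSMFFType2024 F₁ F₂ Ψ hyp.isFrobenioid₁ hyp.isFrobenioid₂ hD₁ hD₂ hs₁ hs₂) hyp

/-- **[FrdI] Cor. 5.7 (i), quasi-base-Frobenius pairs, UNCONDITIONALLY over slim bases of FSMFF-type (revised).**
[cite: MochizukiFrdI2008, Cor. 5.7 (i) p.107] [cite: MochizukiFrdIComments2024, (28) p.3] -/
theorem cor57i_pairs_of_isSlim2024 (hD₁ : IsOfFSMFFType2024 D₁) (hD₂ : IsOfFSMFFType2024 D₂)
    (hs₁ : IsSlim D₁) (hs₂ : IsSlim D₂) : Cor57i_pairs F₁ F₂ Ψ := fun hyp =>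
  cor57i_pairs_of_isOfFSMFFType2024 F₁ F₂ Ψ hD₁ hD₂
    (cor411ii_inst_of_isSlim_of_isOfFSMFFType2024 F₁ F₂ Ψ hyp.isFrobenioid₁ hyp.isFrobenioid₂ hD₁ hD₂ hs₁ hs₂) hyp

/-- **[FrdI] Cor. 5.7 (i), "`C₁` of (pre-)model type iff `C₂` is", UNCONDITIONALLY over slim bases of FSMFF-type
(revised).** [cite: MochizukiFrdI2008, Cor. 5.7 (i) p.107] [cite: MochizukiFrdIComments2024, (28) p.3] -/
theorem isOfPreModelType_iff_of_isSlim2024 (hD₁ : IsOfFSMFFType2024 D₁) (hD₂ : IsOfFSMFFType2024 D₂)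
    (hs₁ : IsSlim D₁) (hs₂ : IsSlim D₂) (hyp : Cor57Hypotheses F₁ F₂ Ψ) :
    IsOfPreModelType F₁ ↔ IsOfPreModelType F₂ :=
  isOfPreModelType_iff_of_isOfFSMFFType2024 F₁ F₂ Ψ hD₁ hD₂
    (cor411ii_inst_of_isSlim_of_isOfFSMFFType2024 F₁ F₂ Ψ hyp.isFrobenioid₁ hyp.isFrobenioid₂ hD₁ hD₂ hs₁ hs₂)
    (cor411ii_inst_of_isSlim_of_isOfFSMFFType2024 F₂ F₁ Ψ.symm hyp.isFrobenioid₂ hyp.isFrobenioid₁ hD₂ hD₁ hs₂ hs₁)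
    hyp

/-- **[FrdI] Cor. 5.7 (ii) UNCONDITIONALLY over slim bases of FSMFF-type (revised)**: `C₁` is of unit-profinite
type iff `C₂` is. [cite: MochizukiFrdI2008, Cor. 5.7 (ii) p.108] [cite: MochizukiFrdIComments2024, (28) p.3] -/
theorem cor57ii_of_isSlim2024 (hD₁ : IsOfFSMFFType2024 D₁) (hD₂ : IsOfFSMFFType2024 D₂) (hs₁ : IsSlim D₁)
    (hs₂ : IsSlim D₂) : Cor57ii F₁ F₂ Ψ := fun hyp =>
  cor57ii_of_cor411ii F₁ F₂ Ψ
    (cor411ii_inst_of_isSlim_of_isOfFSMFFType2024 F₁ F₂ Ψ hyp.isFrobenioid₁ hyp.isFrobenioid₂ hD₁ hD₂ hs₁ hs₂) hyp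

/-- **[FrdI] Cor. 5.7 (iii) UNCONDITIONALLY over slim bases of FSMFF-type (revised).**
[cite: MochizukiFrdI2008, Cor. 5.7 (iii) p.108] [cite: MochizukiFrdIComments2024, (28) p.3] -/
theorem cor57iii_of_isSlim2024 (B₁ : (PreFrobenioidData.ofFunctor Φ₁ F₁).BiratData)
    (B₂ : (PreFrobenioidData.ofFunctor Φ₂ F₂).BiratData) (hD₁ : IsOfFSMFFType2024 D₁) (hD₂ : IsOfFSMFFType2024 D₂)
    (hs₁ : IsSlim D₁) (hs₂ : IsSlim D₂) : Cor57iii F₁ F₂ Ψ B₁ B₂ := fun hyp =>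
  cor57iii_of_isOfFSMFFType2024 F₁ F₂ Ψ B₁ B₂ hD₁ hD₂
    (cor411ii_inst_of_isSlim_of_isOfFSMFFType2024 F₁ F₂ Ψ hyp.isFrobenioid₁ hyp.isFrobenioid₂ hD₁ hD₂ hs₁ hs₂) hyp

/-- **[FrdI] Cor. 5.7 (iv) UNCONDITIONALLY over slim bases of FSMFF-type (revised).**
[cite: MochizukiFrdI2008, Cor. 5.7 (iv) p.108] [cite: MochizukiFrdIComments2024, (28) p.3] -/
theorem cor57iv_of_isSlim2024 (B₁ : (PreFrobenioidData.ofFunctor Φ₁ F₁).BiratData)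
    (B₂ : (PreFrobenioidData.ofFunctor Φ₂ F₂).BiratData) (hD₁ : IsOfFSMFFType2024 D₁) (hD₂ : IsOfFSMFFType2024 D₂)
    (hs₁ : IsSlim D₁) (hs₂ : IsSlim D₂) : Cor57iv F₁ F₂ Ψ B₁ B₂ := fun hyp =>
  cor57iv_of_isOfFSMFFType2024 F₁ F₂ Ψ B₁ B₂ hD₁ hD₂
    (cor411ii_inst_of_isSlim_of_isOfFSMFFType2024 F₁ F₂ Ψ hyp.isFrobenioid₁ hyp.isFrobenioid₂ hD₁ hD₂ hs₁ hs₂) hyp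

end Cor57FSMFF2024

end PreFrobenioid

end Literature.AlgebraicGeometry.Frobenioids
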